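import Summits.BirchSwinnertonDyer.BirchSwinnertonDyer.Theorems.KolyvaginRoadThreeMethod2LocalEquivOfTame
import HarnessLib

/-!
# Route `KolyvaginRoadThree`, deciding crux `ZhangSharpFrameAtThreeHL` (item stmt-BirchSwinnertonDyer-19574):
# the registered stub A `stub_levelRaisingAtThree` (v2x text) from (Cheb) + (Iso) + the TAME SIGN LAW (TS)
# (cell `bsd-stepL`, seat `bsd-stepL-zhang3-p1` g7; `--supports stmt-BirchSwinnertonDyer-19574`, helper)

WHY THIS FILE. With (Line) ∕ (Trans) proved (`KolyvaginRoadThreeMethod2LocalInputsLineTrans`) and (Equiv) reduced to the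
tame sign law (TS) at the good unipotent-admissible prime (`KolyvaginRoadThreeMethod2LocalEquivOfTame`), koly3a's
five-input reduction of the REGISTERED stub A of crux 19574 (`Method2.stub_levelRaisingAtThree_v2w_of_localGlobal`,
p467211; skeleton v2x of koly g12, text byte-identical) shortens to: (Cheb) — Čebotarev with the sign rule (Zhang
Lemma 7.3 ∕ BD05 Thm 3.2 at `p = 3`, koly MEMO-v8 §4); (Iso) — Poitou–Tate isotropy (Zhang Prop. 5.4, MEMO-v8 §5; tree
suppliers listed by koly g12); (TS) — conjugation by the Frobenius lift `t` of `c` (and by `F = t²`) fixes the values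
of every continuous cocycle `Γ_K → E(K̄)[3]` on the inertia group `I_𝔓` (Serre 1972 §1.8 Prop. 6: Frobenius acts on
tame inertia by `u ↦ u^q`, and `q ≡ 1 (mod 3)`; tree supplier in LOCAL-field form:
`GaloisRepresentations.InertiaHomFrobeniusTwist.apply_conj_eq_pow_nsmul_of_isFrobPow`,
`FrobeniusOnTameInertiaImage.apply_frob_conj_eq_of_map_absInertia_eq_zpowers`; the number-field bridge at `𝔓_{ι₀,𝔐}`
(`DecompositionGroupOfCompletion`) is the remaining plumbing). CONDITIONAL on the three binders; nothing is booked; the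
stub is NOT proved; the owner assembles. PARTITION: O2@3 (B10) × A1 × crux 19574 × stub A — none (T7).

References: [cite: WZhang2014, Prop. 5.4, Lemma 7.3, §9 (9.1)–(9.3)] [cite: BertoliniDarmon2005, Lemma 2.6, Thm. 3.2]
[cite: SerreInventiones1972, §1.8 Prop. 6].
-/

noncomputable section

open scoped Classical

namespace Summit.BirchSwinnertonDyer.Rank1Residual.X11b.Three.Koly.Method2

open WeierstrassCurve NumberField IsDedekindDomain Field
  Literature.NumberTheory.EllipticCurves Literature.NumberTheory.EllipticCurves.ModularForms
  Literature.NumberTheory.GaloisRepresentations Module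

/-- **`stub_levelRaisingAtThree` — the REGISTERED v2x text — FROM (Cheb) + (Iso) + the TAME SIGN LAW (TS), frame-wise.**
At every Hoffstein–Luo A1 frame (so `[K : ℚ] = 2`) and every complex conjugation `c ≠ 1` with the `ZMod 3`-structure of
`H¹(K, E[3])`, the hypothesis asks (Cheb), (Iso) (as in koly3a's reduction) and (TS): at every place `v ∋ q` of a
unipotent-admissible `q`, for every arithmetic Frobenius `h ∈ Γ_ℚ` below `𝔓_{ι₀,𝔐}` whose transport lifts `c` and every
`F ∈ Γ_K` with `res F = h²`, every continuous cocycle `φ : Γ_K → E(K̄)[3]` has `φ(t⁻¹ i t) = φ(i) = φ(F i F⁻¹)` on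
`I_𝔓`. (Line), (Trans) are the kernel theorems `localLine_of_uAdmissible` ∕ `localTrans_of_uAdmissible`, (Equiv) is
`localEquiv_of_tameSign`. The conclusion is the registered stub signature VERBATIM. CONDITIONAL; nothing is booked.
[cite: WZhang2014, Prop. 5.4, Lemma 7.3, §9 (9.1)–(9.3)] [cite: SerreInventiones1972, §1.8 Prop. 6] -/
theorem stub_levelRaisingAtThree_of_cheb_iso_tameSign
    (hLG : ∀ (W : WeierstrassCurve ℚ) [W.IsElliptic] [W.IsGloballyMinimal] [NeZero (W.conductorNorm ℤ)] (K : Type)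
      [Field K] [NumberField K] (Dt : ModularParametrizationData W (W.conductorNorm ℤ)) (β : ℤ) (ι : K →+* ℂ),
      Summit.BirchSwinnertonDyer.Rank1Residual.ClassX11b W 3 → W.HasMultiplicativeReductionAtPrime 3 →
      Literature.NumberTheory.EllipticCurves.Rank1Residual.Surj W 3 →
      Literature.NumberTheory.EllipticCurves.Rank1Residual.Ram W 3 → ¬ 3 ∣ W.tamagawaProduct →
      IsImaginaryQuadratic K → Odd (NumberField.discr K) → SatisfiesHeegnerHypothesis (W.conductorNorm ℤ) K →
      (W.quadraticTwist (NumberField.discr K : ℚ)).entireLFunction 1 ≠ 0 → NumberField.discr K ≠ -3 →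
      (4 * (W.conductorNorm ℤ : ℤ)) ∣ β ^ 2 - NumberField.discr K → ¬ (3 : ℤ) ∣ Dt.c →
      ∀ (c : K ≃ₐ[ℚ] K), c ≠ 1 → ∀ [Module (ZMod 3) (V3 W K)],
      -- (Cheb)
      (∀ (n : Finset {q // IsUAdmissiblePrime W K q}) (μ : Bool) (x : V3 W K), GoodLevel W K n →
        x ∈ SelQ W K c n μ → x ≠ 0 →
        ∃ q : {q // IsUAdmissiblePrime W K q}, q ∉ n ∧ FrobSqNeOneAt W 3 q.1 ∧ ∃ v : HeightOneSpectrum (𝓞 K),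
          ((q : ℕ) : 𝓞 K) ∈ v.asIdeal ∧
            (W.baseChange K).torsionLocMap (v.adicCompletion K) ((3 ^ 1 : ℕ) : ℤ) x ≠ 0) ∧
      -- (Iso)
      (∀ (n : Finset {q // IsUAdmissiblePrime W K q}) (q : {q // IsUAdmissiblePrime W K q}) (μ : Bool),
        GoodLevel W K n → FrobSqNeOneAt W 3 q.1 → q ∉ n →
        ∀ v : HeightOneSpectrum (𝓞 K), ((q : ℕ) : 𝓞 K) ∈ v.asIdeal →
        ∀ y ∈ SelRelQ W K c (insert q n) {q} μ, ∀ z ∈ SelRelQ W K c (insert q n) {q} μ,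
          (W.baseChange K).torsionLocMap (v.adicCompletion K) ((3 ^ 1 : ℕ) : ℤ) z ≠ 0 →
          ∃ a : ℤ, (W.baseChange K).torsionLocMap (v.adicCompletion K) ((3 ^ 1 : ℕ) : ℤ) y =
            a • (W.baseChange K).torsionLocMap (v.adicCompletion K) ((3 ^ 1 : ℕ) : ℤ) z) ∧
      -- (TS) the tame sign law at the places above unipotent-admissible primes
      (∀ (v : HeightOneSpectrum (𝓞 K)) (𝔐 : Ideal (HeightOneSpectrum.localAbsIntegers v)),
        𝔐 ∈ v.localPrimesAbove → ∀ q : ℕ, IsUAdmissiblePrime W K q → (q : 𝓞 K) ∈ v.asIdeal →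
        ∀ (h : absoluteGaloisGroup ℚ) (F : absoluteGaloisGroup K),
          IsArithFrobAt (𝓞 ℚ) h ((v.primeBelow (closureEmb (K := K) (v.adicCompletion K)) 𝔐).comap
            (absIntegersMap ℚ K)) → absGaloisRestrict ℚ K F = h ^ 2 →
        ∀ (ht : IsLiftOfAut c (absGaloisTransport (K := ℚ) (L := K) h).toRingEquiv)
          (φ : contOneCocycles (discreteTopRep (absoluteGaloisGroup K)
            (geomTorsion (W.baseChange K) ((3 ^ 1 : ℕ) : ℤ)))),
        ∀ i ∈ (v.primeBelow (closureEmb (K := K) (v.adicCompletion K)) 𝔐).inertia (absoluteGaloisGroup K),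
          φ.1 (ht.conjGalCMH i) = φ.1 i ∧ φ.1 (F * i * F⁻¹) = φ.1 i)) :
    ∀ (W : WeierstrassCurve ℚ) [W.IsElliptic] [W.IsGloballyMinimal] [NeZero (W.conductorNorm ℤ)] (K : Type)
      [Field K] [NumberField K] (Dt : ModularParametrizationData W (W.conductorNorm ℤ)) (β : ℤ) (ι : K →+* ℂ),
      Summit.BirchSwinnertonDyer.Rank1Residual.ClassX11b W 3 → W.HasMultiplicativeReductionAtPrime 3 →
      Literature.NumberTheory.EllipticCurves.Rank1Residual.Surj W 3 →
      Literature.NumberTheory.EllipticCurves.Rank1Residual.Ram W 3 → ¬ 3 ∣ W.tamagawaProduct →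
      IsImaginaryQuadratic K → Odd (NumberField.discr K) → SatisfiesHeegnerHypothesis (W.conductorNorm ℤ) K →
      (W.quadraticTwist (NumberField.discr K : ℚ)).entireLFunction 1 ≠ 0 → NumberField.discr K ≠ -3 →
      (4 * (W.conductorNorm ℤ : ℤ)) ∣ β ^ 2 - NumberField.discr K → ¬ (3 : ℤ) ∣ Dt.c →
      ∀ (c : K ≃ₐ[ℚ] K), c ≠ 1 → ∀ [Module (ZMod 3) (V3 W K)],
      -- (A1) rank lowering at one new GOOD (non-scalar) unipotent-admissible prime, on good levels, (9.1)–(9.2)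
      (∀ (n : Finset {q // IsUAdmissiblePrime W K q}) (μ : Bool) (x : V3 W K),
        GoodLevel W K n → x ∈ SelQ W K c n μ → x ≠ 0 →
        ∃ q : {q // IsUAdmissiblePrime W K q}, q ∉ n ∧ GoodLevel W K (insert q n) ∧
          x ∉ SelQ W K c (insert q n) μ ∧
          SelQ W K c (insert q n) μ ≤ SelQ W K c n μ ∧
          finrank (ZMod 3) (SelQ W K c (insert q n) μ) + 1 = finrank (ZMod 3) (SelQ W K c n μ) ∧
          SelQ W K c (insert q n) (!μ) = SelQ W K c n (!μ)) := by
  intro W _ _ _ K _ _ Dt β ι hX hmult hsurj hram htam hK hodd hH hLt h3 hβ hc c hc1 _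
  obtain ⟨hcheb, hiso, hTS⟩ := hLG W K Dt β ι hX hmult hsurj hram htam hK hodd hH hLt h3 hβ hc c hc1
  exact selQ_rankLowering_on_of_localGlobal W K c hcheb (localEquiv_of_tameSign W K hK.1 hc1 hTS)
    (localLine_of_uAdmissible W K hK.1) (localTrans_of_uAdmissible W K hK.1) hiso

end Summit.BirchSwinnertonDyer.Rank1Residual.X11b.Three.Koly.Method2

end
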